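import Literature.AlgebraicGeometry.Resolution.TameAbelianToricDescent
import HarnessLib

/-!
# TameAbelianMonomialChart — the abelian toric descent step with the chart EXPOSED AS MONOMIALS (two-storey cell, STEP D)
(decomp-res lens-1 g28 preparation I; NEXT-g29-E §2 STEP D)

`Literature…TameAbelianToricDescent.exists_fixed_toricChart_of_commuting(_isRegularLocalRing)` returns the jointly
fixed toric chart
`y` behind an existential (`∃ y, … y k = a / c …`).  The two-storey cell needs the chart AS LAURENT MONOMIALS `y k =
∏ j, x j ^ n k j` in the
GIVEN joint eigenparameters `x` — because then an automorphism `g` of the whole decomposition group with `g (x j) =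
ε j · x j` acts on the chart
by units: `g (y k) = (∏ j, ε j ^ n k j) · y k` (`apply_prod_zpow_eq`), which is what makes the chart ring stable
under the quotient group
(NEXT-g29-E §1 (5)).  The two theorems below are the tree's, VERBATIM, with the exponent matrix `n` exported instead of `y`
(re-glue only; the mathematics is [CoP1] Prop. 6.2 (2) / Lemma 9.4 (53)–(54) and Fulton §2.6, as cited there).
-/

noncomputable section

open IsLocalRing Literature.AlgebraicGeometry.Resolution

namespace Summit.ResolutionOfSingularities.ResolutionOfSingularities.Theorems.TameAbelianMonomialChart

universe u

variable {F : Type u} [Field F] (O : ValuationSubring F)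

/-- `∏ⱼ a^{fⱼ} = a^{∑ fⱼ}` for integer exponents and `a ≠ 0` (copy of the tree's private helper). [folklore] -/
theorem prod_zpow_eq_zpow_sum {a : F} (ha : a ≠ 0) {ι : Type*} (s : Finset ι)
    (f : ι → ℤ) : ∏ j ∈ s, a ^ f j = a ^ ∑ j ∈ s, f j := by
  classical
  induction s using Finset.induction_on with
  | empty => simp
  | insert j s hj ih => rw [Finset.prod_insert hj, Finset.sum_insert hj, ih, zpow_add₀ ha]

/-- **Semi-invariance of Laurent monomials**: if `g (x j) = ε j · x j` then `g (∏ x j ^ n j) = (∏ ε j ^ n j) · ∏ x j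
^ n j`. [folklore] -/
theorem apply_prod_zpow_eq {d : ℕ} (g : F ≃+* F) (x ε : Fin d → F) (hgx : ∀ j, g (x j) = ε j * x j)
    (n : Fin d → ℤ) : g (∏ j, x j ^ n j) = (∏ j, ε j ^ n j) * ∏ j, x j ^ n j := by
  rw [map_prod, ← Finset.prod_mul_distrib]
  exact Finset.prod_congr rfl fun j _ => by rw [map_zpow₀, hgx, mul_zpow]

/-- **The toric descent step for a commuting family of tame automorphisms, monomial form** —
`exists_fixed_toricChart_of_commuting`
with the exponent matrix `n` of the chart `y k = ∏ j, x j ^ n k j` exported. (Sources: CossartPiltant2008, Prop. 6.2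
(2) and proof of Lemma 9.4 (HAL pp. 19, 28–29); Fulton1993Toric, Section 2.6 (pp. 45–50).) -/
theorem exists_fixed_monomialChart_of_commuting (τ : ℕ → F ≃+* F) (r : ℕ) {ℓ : ℕ} (hℓ0 : ℓ ≠ 0)
    (hτℓ : ∀ i < r, τ i ^ ℓ = 1)
    (hcomm : ∀ i < r, ∀ i' < r, ∀ z : F, τ i (τ i' z) = τ i' (τ i z))
    (B : Subring F) [IsLocalRing B] [IsNoetherianRing B] (hBO : B ≤ O.toSubring)
    (hdomB : ∀ b : B, b ∈ maximalIdeal B ↔ O.valuation (b : F) < 1)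
    (hτB : ∀ i < r, ∀ b ∈ B, τ i b ∈ B) (hℓu : IsUnit ((ℓ : B)))
    (ζ : F) (hζB : ζ ∈ B) (hτζ : ∀ i < r, τ i ζ = ζ) (hζℓ : ζ ^ ℓ = 1)
    (hζu : ∀ k : ℕ, 0 < k → k < ℓ → IsUnit ((⟨ζ, hζB⟩ : B) ^ k - 1))
    (hres : ∀ i < r, ∀ b ∈ B, O.valuation (τ i b - b) < 1)
    {d : ℕ} (x : Fin d → F) (hxB : ∀ j, x j ∈ B) (hx0 : ∀ j, x j ≠ 0)
    (hspan : Ideal.span (Set.range fun j => (⟨x j, hxB j⟩ : B)) = maximalIdeal B)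
    (s : ℕ → Fin d → ℕ) (hτx : ∀ i < r, ∀ j, τ i (x j) = ζ ^ s i j * x j)
    (A : Subring F) (hA : ∀ b, b ∈ A ↔ b ∈ B ∧ ∀ i < r, τ i b = b) :
    ∃ n : Fin d → (Fin d → ℤ),
      (∀ i < r, ∀ k, τ i (∏ j, x j ^ n k j) = ∏ j, x j ^ n k j) ∧ (∀ k, (∏ j, x j ^ n k j) ∈ O) ∧
      (∀ k, ∃ a ∈ A, ∃ c ∈ A, c ≠ 0 ∧ (∏ j, x j ^ n k j) = a / c) ∧
      (ringKrullDim (locAtCentre (Subring.closure ((A : Set F) ∪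
          Set.range fun k => ∏ j, x j ^ n k j)) O) = d →
        IsRegularLocalRing (locAtCentre (Subring.closure ((A : Set F) ∪
          Set.range fun k => ∏ j, x j ^ n k j)) O)) := by
  classical
  have hℓpos : 0 < ℓ := Nat.pos_of_ne_zero hℓ0
  -- the parameters as monomials `x^{eⱼ}`
  let g : Fin d → (Fin d → ℕ) := fun j => Pi.single j 1
  have hxg : ∀ j, (∏ i, x i ^ g j i) = x j := fun j => by
    change (∏ i, x i ^ (Pi.single j 1 : Fin d → ℕ) i) = x j
    rw [Finset.prod_eq_single j (fun i _ hij => by rw [Pi.single_eq_of_ne hij, pow_zero])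
      (fun h => absurd (Finset.mem_univ j) h), Pi.single_eq_same, pow_one]
  have hgB : ∀ j, (∏ i, x i ^ g j i) ∈ B := fun j => by rw [hxg]; exact hxB j
  have hspan' : Ideal.span (Set.range fun j => (⟨∏ i, x i ^ g j i, hgB j⟩ : B)) =
      maximalIdeal B := by
    have : (fun j => (⟨∏ i, x i ^ g j i, hgB j⟩ : B)) = fun j => ⟨x j, hxB j⟩ :=
      funext fun j => Subtype.ext (hxg j)
    rw [this, hspan]
  -- monomial generators of `𝔪_A`
  obtain ⟨hAloc, hAnoe, hdomA, m', g', hg'A, -, hdiv, hspanA⟩ :=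
    exists_monomial_generators_fixedSubring_of_commuting O τ r hℓ0 hτℓ hcomm B hdomB hτB hℓu ζ
      hζB hτζ hζℓ hζu hres x s hτx g hgB hspan' A hA
  haveI := hAloc
  haveI := hAnoe
  have hAle : A ≤ B := fun a ha => ((hA a).mp ha).1
  have hAO : A ≤ O.toSubring := fun a ha => hBO (hAle ha)
  -- the lattice of joint invariant exponents
  let N : AddSubgroup (Fin d → ℤ) :=
    { carrier := {v | ∀ i < r, (ℓ : ℤ) ∣ ∑ j, (s i j : ℤ) * v j}
      add_mem' := fun {u v} hu hv i hi => by
        simp only [Pi.add_apply, mul_add, Finset.sum_add_distrib]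
        exact dvd_add (hu i hi) (hv i hi)
      zero_mem' := fun i _ => by simp
      neg_mem' := fun {v} hv i hi => by
        simp only [Pi.neg_apply, mul_neg, Finset.sum_neg_distrib]
        exact (dvd_neg).mpr (hv i hi) }
  have hmemN : ∀ v : Fin d → ℤ, v ∈ N ↔ ∀ i < r, (ℓ : ℤ) ∣ ∑ j, (s i j : ℤ) * v j :=
    fun v => Iff.rfl
  have hN : ∀ v : Fin d → ℤ, ℓ • v ∈ N := fun v i _ => by
    refine ⟨∑ j, (s i j : ℤ) * v j, ?_⟩
    rw [Finset.mul_sum]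
    exact Finset.sum_congr rfl fun j _ => by rw [Pi.smul_apply, nsmul_eq_mul]; ring
  have hnatN : ∀ w : Fin d → ℕ, (∀ i < r, ℓ ∣ ∑ j, s i j * w j) → (fun j => (w j : ℤ)) ∈ N := by
    intro w hw i hi
    have h := Int.natCast_dvd_natCast.mpr (hw i hi)
    push_cast at h
    exact h
  -- the regular toric chart for `N`
  obtain ⟨n, hnN, hyO, -, hreg⟩ := exists_toricChart_isRegularLocalRing_of_addSubgroup O A hAO
    hdomA hℓpos N hN x hx0 (fun j => hBO (hxB j)) _ hspanA
    (by rintro _ ⟨k, rfl⟩; exact ⟨g' k, hnatN _ (fun i hi => hdiv i hi k), rfl⟩)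
  have hζ0 : ζ ≠ 0 := fun h => by
    rw [h, zero_pow hℓ0] at hζℓ; exact zero_ne_one hζℓ
  -- invariant monomials lie in `A`
  have hτmon : ∀ i < r, ∀ w : Fin d → ℕ,
      τ i (∏ j, x j ^ w j) = ζ ^ (∑ j, s i j * w j) * ∏ j, x j ^ w j := by
    intro i hi w
    calc τ i (∏ j, x j ^ w j) = ∏ j, (ζ ^ s i j * x j) ^ w j := by
          rw [map_prod]; exact Finset.prod_congr rfl fun j _ => by rw [map_pow, hτx i hi]
      _ = ζ ^ (∑ j, s i j * w j) * ∏ j, x j ^ w j := by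
          rw [← Finset.prod_pow_eq_pow_sum, ← Finset.prod_mul_distrib]
          exact Finset.prod_congr rfl fun j _ => by rw [mul_pow, pow_mul]
  have hmonA : ∀ w : Fin d → ℕ, (∀ i < r, ℓ ∣ ∑ j, s i j * w j) → (∏ j, x j ^ w j) ∈ A := by
    intro w hw
    rw [hA]
    refine ⟨B.prod_mem fun j _ => B.pow_mem (hxB j) _, fun i hi => ?_⟩
    obtain ⟨q, hq⟩ := hw i hi
    rw [hτmon i hi, hq, pow_mul, hζℓ, one_pow, one_mul]
  refine ⟨n, fun i hi k => ?_, hyO, fun k => ?_, hreg⟩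
  · -- fixed by `τ i`
    obtain ⟨q, hq⟩ := (hmemN _).mp (hnN k) i hi
    calc τ i (∏ j, x j ^ n k j) = ∏ j, (ζ ^ s i j * x j) ^ n k j := by
          rw [map_prod]; exact Finset.prod_congr rfl fun j _ => by rw [map_zpow₀, hτx i hi]
      _ = (∏ j, ζ ^ ((s i j : ℤ) * n k j)) * ∏ j, x j ^ n k j := by
          rw [← Finset.prod_mul_distrib]
          exact Finset.prod_congr rfl fun j _ => by rw [mul_zpow, zpow_mul, zpow_natCast]
      _ = ∏ j, x j ^ n k j := by
          rw [prod_zpow_eq_zpow_sum hζ0, hq, zpow_mul, zpow_natCast, hζℓ, one_zpow, one_mul]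
  · -- `y = x^{n⁺ + (ℓ-1)n⁻} / x^{ℓ n⁻}`
    let np : Fin d → ℕ := fun j => (n k j).toNat
    let nm : Fin d → ℕ := fun j => (-n k j).toNat
    have hnpm : ∀ j, (np j : ℤ) - nm j = n k j := fun j => Int.toNat_sub_toNat_neg _
    refine ⟨∏ j, x j ^ (np j + (ℓ - 1) * nm j), hmonA _ ?_, ∏ j, x j ^ (ℓ * nm j), hmonA _ ?_,
      Finset.prod_ne_zero_iff.mpr fun j _ => pow_ne_zero _ (hx0 j), ?_⟩
    · intro i hi
      obtain ⟨q, hq⟩ := (hmemN _).mp (hnN k) i hi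
      have h1 : ((∑ j, s i j * (np j + (ℓ - 1) * nm j) : ℕ) : ℤ) =
          (∑ j, (s i j : ℤ) * n k j) + ℓ * ∑ j, (s i j : ℤ) * nm j := by
        push_cast
        rw [Finset.mul_sum, ← Finset.sum_add_distrib]
        refine Finset.sum_congr rfl fun j _ => ?_
        rw [← hnpm j, Nat.cast_sub hℓpos]
        push_cast
        ring
      have h2 : ((ℓ : ℕ) : ℤ) ∣ ((∑ j, s i j * (np j + (ℓ - 1) * nm j) : ℕ) : ℤ) := by
        rw [h1, hq]
        exact dvd_add (dvd_mul_right _ _) (dvd_mul_right _ _)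
      exact Int.natCast_dvd_natCast.mp h2
    · intro i _
      rw [show (∑ j, s i j * (ℓ * nm j)) = ℓ * ∑ j, s i j * nm j by
        rw [Finset.mul_sum]; exact Finset.sum_congr rfl fun j _ => by ring]
      exact dvd_mul_right _ _
    · rw [eq_div_iff (Finset.prod_ne_zero_iff.mpr fun j _ => pow_ne_zero _ (hx0 j)),
        ← Finset.prod_mul_distrib]
      refine Finset.prod_congr rfl fun j _ => ?_
      rw [← zpow_natCast, ← zpow_natCast, ← zpow_add₀ (hx0 j)]
      congr 1
      rw [← hnpm j]
      push_cast
      rw [Nat.cast_sub hℓpos]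
      push_cast
      ring

/-- **The abelian toric descent step, monomial form, dimension discharged** —
`exists_fixed_toricChart_of_commuting_isRegularLocalRing` with the
exponent matrix exported. (Sources: CossartPiltant2008, Prop. 6.2 (2) and proof of Lemma 9.4 (HAL pp. 19, 28–29);
Fulton1993Toric, Section 2.6.) -/
theorem exists_fixed_monomialChart_of_commuting_isRegularLocalRing (τ : ℕ → F ≃+* F) (r : ℕ)
    {ℓ : ℕ} (hℓ0 : ℓ ≠ 0) (hτℓ : ∀ i < r, τ i ^ ℓ = 1)
    (hcomm : ∀ i < r, ∀ i' < r, ∀ z : F, τ i (τ i' z) = τ i' (τ i z))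
    (B : Subring F) [IsLocalRing B] [IsNoetherianRing B] (hBO : B ≤ O.toSubring)
    (hdomB : ∀ b : B, b ∈ maximalIdeal B ↔ O.valuation (b : F) < 1)
    (hτB : ∀ i < r, ∀ b ∈ B, τ i b ∈ B) (hℓu : IsUnit ((ℓ : B)))
    (ζ : F) (hζB : ζ ∈ B) (hτζ : ∀ i < r, τ i ζ = ζ) (hζℓ : ζ ^ ℓ = 1)
    (hζu : ∀ k : ℕ, 0 < k → k < ℓ → IsUnit ((⟨ζ, hζB⟩ : B) ^ k - 1))
    (hres : ∀ i < r, ∀ b ∈ B, O.valuation (τ i b - b) < 1)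
    {d : ℕ} (hBdim : ringKrullDim B = d) (x : Fin d → F) (hxB : ∀ j, x j ∈ B)
    (hx0 : ∀ j, x j ≠ 0)
    (hspan : Ideal.span (Set.range fun j => (⟨x j, hxB j⟩ : B)) = maximalIdeal B)
    (s : ℕ → Fin d → ℕ) (hτx : ∀ i < r, ∀ j, τ i (x j) = ζ ^ s i j * x j)
    (A : Subring F) (hA : ∀ b, b ∈ A ↔ b ∈ B ∧ ∀ i < r, τ i b = b)
    (hAuc : IsUniversallyCatenaryRing A)
    (halgA : ∀ z : O, ∃ q : Polynomial A, (∃ i, IsUnit (q.coeff i)) ∧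
      O.valuation (Polynomial.aeval (z : F) q) < 1) :
    ∃ n : Fin d → (Fin d → ℤ),
      (∀ i < r, ∀ k, τ i (∏ j, x j ^ n k j) = ∏ j, x j ^ n k j) ∧ (∀ k, (∏ j, x j ^ n k j) ∈ O) ∧
      IsRegularLocalRing (locAtCentre (Subring.closure ((A : Set F) ∪
        Set.range fun k => ∏ j, x j ^ n k j)) O) := by
  classical
  obtain ⟨n, hτy, hyO, hfrac, hreg⟩ := exists_fixed_monomialChart_of_commuting O τ r hℓ0 hτℓ hcomm B
    hBO hdomB hτB hℓu ζ hζB hτζ hζℓ hζu hres x hxB hx0 hspan s hτx A hA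
  set y : Fin d → F := fun k => ∏ j, x j ^ n k j with hy_def
  refine ⟨n, hτy, hyO, hreg ?_⟩
  -- `A` is local, dominated by `O` (through the monomial-generator iteration)
  let g : Fin d → (Fin d → ℕ) := fun j => Pi.single j 1
  have hxg : ∀ j, (∏ i, x i ^ g j i) = x j := fun j => by
    change (∏ i, x i ^ (Pi.single j 1 : Fin d → ℕ) i) = x j
    rw [Finset.prod_eq_single j (fun i _ hij => by rw [Pi.single_eq_of_ne hij, pow_zero])
      (fun h => absurd (Finset.mem_univ j) h), Pi.single_eq_same, pow_one]
  have hgB : ∀ j, (∏ i, x i ^ g j i) ∈ B := fun j => by rw [hxg]; exact hxB j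
  have hspan' : Ideal.span (Set.range fun j => (⟨∏ i, x i ^ g j i, hgB j⟩ : B)) =
      maximalIdeal B := by
    have : (fun j => (⟨∏ i, x i ^ g j i, hgB j⟩ : B)) = fun j => ⟨x j, hxB j⟩ :=
      funext fun j => Subtype.ext (hxg j)
    rw [this, hspan]
  obtain ⟨hAloc, -, hdomA, -⟩ :=
    exists_monomial_generators_fixedSubring_of_commuting O τ r hℓ0 hτℓ hcomm B hdomB hτB hℓu ζ
      hζB hτζ hζℓ hζu hres x s hτx g hgB hspan' A hA
  haveI := hAloc
  have hAle : A ≤ B := fun a ha => ((hA a).mp ha).1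
  have hAO : A ≤ O.toSubring := fun a ha => hBO (hAle ha)
  have hdomA' : ∀ a : A, a ∈ maximalIdeal A → O.valuation (a : F) < 1 := fun a => (hdomA a).mp
  have halgA' : ∀ z : O, ∃ q : Polynomial A, (∃ i, q.coeff i ∉ maximalIdeal A) ∧
      O.valuation (Polynomial.aeval (z : F) q) < 1 := by
    intro z
    obtain ⟨q, ⟨i, hi⟩, hq⟩ := halgA z
    exact ⟨q, ⟨i, fun h => (IsLocalRing.mem_maximalIdeal _ |>.mp h) hi⟩, hq⟩
  -- `dim A = dim B = d`
  have hdimA : ringKrullDim A = d := by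
    rw [← hBdim]
    exact ringKrullDim_fixedSubring_of_commuting_eq τ r hℓ0 hτℓ hcomm B hτB hℓu ζ hζB hτζ hζℓ hζu
      A hA
  -- the dimension formula for the fractions `yᵢ`
  have hb : ∀ w ∈ (Finset.univ.image y : Finset F), ∃ a c : A, (c : F) ≠ 0 ∧ w = a / c := by
    intro w hw
    obtain ⟨i, -, rfl⟩ := Finset.mem_image.mp hw
    obtain ⟨a, ha, c, hc, hc0, hy⟩ := hfrac i
    exact ⟨⟨a, ha⟩, ⟨c, hc⟩, hc0, hy⟩
  have hrange : ((Finset.univ.image y : Finset F) : Set F) = Set.range y := by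
    rw [Finset.coe_image, Finset.coe_univ, Set.image_univ]
  have hTO : Subring.closure ((A : Set F) ∪ ↑(Finset.univ.image y : Finset F)) ≤ O.toSubring := by
    rw [hrange]
    exact Subring.closure_le.mpr (Set.union_subset hAO (by rintro _ ⟨i, rfl⟩; exact hyO i))
  have h := ringKrullDim_locAtCentre_closure_eq O hAuc hAO hdomA' halgA' (Finset.univ.image y) hb hTO
  rw [hrange, hdimA] at h
  exact h

end Summit.ResolutionOfSingularities.ResolutionOfSingularities.Theorems.TameAbelianMonomialChart

end
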